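import Literature.MathematicalPhysics.QuantumFieldTheory.Balaban1983to89.T4MeanChannel
import Literature.MathematicalPhysics.QuantumFieldTheory.Balaban1983to89.B6KernelComposition

/-!
# T4 — the LEVEL-LOCAL BUDGET `B` FROM LATTICE DECAY WITH FIBRE MULTIPLICITY
# (kernel half (S) of the carver's row `T4-O3.E-ii-CDEC°`; pv05 lineage, surge node #05 gen 9)

Position in the cell's T4 programme (pub-balaban, `t4/T4-DAG.md` v9 §5 row `T4-O3.E-ii-CDEC°`,
«EST (paper, L) + kernel instance (S)»): a NEW small leaf on top of K7 = `T4MeanChannel`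
(imported; through it K6 = `T4TowerDecorrelation`, K5 = `T4PairDecorrelation`, K10/K11 =
`T4CoReadMoment`) and of the lattice-sum module `B6KernelComposition` (`latticeConst`,
`sum_exp_dist_le`).  Companion EST record: `t4/T4-EST-O3Eii-CDEC.md` (pv05 lineage).

## HONEST FRAMING (read first)

Nothing in this file is an estimate for Bałaban's renormalization transformations, and nothing
of any manuscript is asserted.  Every declaration is `[folklore]` finite-sum real analysis or an
instance of the already-landed hypothesis SHAPES K5/K6/K7 obtained from two further hypothesis
SHAPES — (hdec) a same-level covariance kernel dominated by `Aκ·e^{−a·|site p − site q|_∞}` on a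
lattice `ℤ^d` of block labels, and (hfib) at most `M` pieces per (level, block) — which are the
form in which the row's located number `B` would be delivered.  The supplied budget is the ONE
explicit number `B = M · Aκ · latticeConst d a`, `latticeConst d a = (2/(1 − e^{−a/d}))^d`
(pv08/B6 lineage, `B6KernelComposition.sum_exp_dist_le`: `Σ_{z ∈ Ω} e^{−a|x − z|_∞} ≤ latticeConst d a`
for EVERY finite `Ω ⊂ ℤ^d`), independent of the number of pieces, of the number of levels and of
the volume.  Whether Bałaban's conditional one-step laws deliver (hdec) with level-independent
`(Aκ, a)` is the row's PAPER half — located, NOT estimated, NOT printed (record §3–§5).  The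
module is NOT summit progress and changes no count of the cell's residual ledger.

## CITATION HEADER (CONTEXT ONLY — the printed SPECIES of (hdec), not an instance of it)

Both sentences were read by this seat on the rendered journal pages as images (2026-08-19):
* [Balaban1985BackgroundPropagators] CMP 99, p. 432, Theorem 3.15: *"For Mα₀ sufficiently small
  the propagator C^{(k)}(Λ) is given by the formula (3.185), and satisfies the bound
  |C^{(k)}(Λ; y,y′)| ≦ B₀e^{−δ₀|y−y′|}, y, y′ ∈ Λ (3.187) with the constants B₀, δ₀ depending on
  d and L only. This propagator has a convergent random walk expansion of the type described
  previously."* — the covariance of ONE step's GAUSSIAN fluctuation integral (p. 427: *"After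
  each renormalization transformation we have to calculate a Gaussian integral. … covariances,
  which are unit lattice operators"*) decays exponentially on the unit lattice with
  level-independent constants: the Gaussian species of (hdec).
* [Balaban1988RG2Cluster] CMP 116, p. 20, Lemma 3: *"the activity H(Z) for a localization
  domain Z∈D_{k+1} satisfies the inequality |H(Z)| ≦ C₃ε₁ exp(−(1 − 8δ)½Lκd_{k+1}(Z)). (2.38)"*
  — exponential tree decay of ONE step's cluster-expansion ACTIVITIES: the interacting species.
As recorded in the cell's GAPS (G-pv18g6-1 and updates; G-pv28g6-1 (N3a) «TERMS ≠ MOMENTS»):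
decay of truncated CONDITIONAL EXPECTATIONS of local fluctuation-field observables is printed
NOWHERE in [B5]–[B16]; the nearest published statement of that species in the programme's
framework concerns another model ([Balaban–Imbrie–Jaffe 1988] CMP 114 p. 272, abelian Higgs:
*"truncated expectation values in the interacting fluctuation measure … can be given a cluster
expansion exhibiting their locality properties"*, OCR locator) and is CONTEXT, not a citable
input for the gauge model.

## WHAT IS TYPED AND PROVED (all [folklore]; S1–S12)

§1 LATTICE ROW SUMS WITH FIBRE MULTIPLICITY (plain data: a finite index set `s`, a block-label
map `site : ι → ℤ^d` (sup metric), a real fibre bound `M`):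
* (S1) `sum_exp_dist_fibre_le` — `#{q ∈ s : site q = z} ≤ M` for all `z` ⇒
  `Σ_{q ∈ s} e^{−a|x − site q|} ≤ M · latticeConst d a` (regroup by fibres, then B6).
* (S2)/(S2ᵀ) `rowSum_le_of_siteDecay` / `colSum_le_of_siteDecay` — a kernel row (column)
  dominated by `Aκ e^{−a|site p − site q|}` sums to `≤ M·Aκ·latticeConst d a`.
§2 (S3) `pairDecorrelation_of_siteDecay` — K5's level-blind shape `PairDecorrelation μ s X σ κ B`
  with `B = M·Aκ·latticeConst d a` from (hcov) + (hdec) + (hfib).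
§3 LEVEL-LOCAL INSTANCES (K7's conditionally centred bookkeeping, `ν = 0`):
* (S4)/(S4ᵀ) `sameLevel_rowSum_le` / `sameLevel_colSum_le` — the hypotheses `hrow`/`hcol` of
  `T4MeanChannel.pairDecorrelation_sameLevel` from same-level decay + per-(level, block) fibres.
* (S5) `pairDecorrelation_sameLevel_of_siteDecay`, (S6) `towerDecorrelation_sameLevel_of_siteDecay`,
  (S7) `integral_sq_sum_le_of_siteDecay`, (S8) HEADLINE
  `log_integral_exp_neg_sum_le_line_of_siteDecay`:
  `0 ≤ log ∫ e^{−Σ c_pX_p} dμ ≤ (M·Aκ·latticeConst d a)·N₀A/(1−r)` — K7's headline BY NAME.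
§4 THE MEAN-CHANNEL ROUTE (K7 (M3), pieces NOT conditionally centred):
* (S9) `downSum_le_of_ancestorDecay` / (S9ᵀ) `sameLevelT_le_of_ancestorDecay` — the clauses
  `hdown : Σ_{q : lvl q + g = lvl p} κ₀(p,q) ≤ B·Λ^g` and `hsameT` of
  `T4MeanChannel.towerDecorrelation_of_meanChannel` from decay in the distance between `p`'s
  block and the level-`lvl p` ANCESTOR block of `q` (`anc : ℕ → ι → ℤ^d`) + NESTED fibre counts
  `#{q : lvl q + g = i, anc i q = z} ≤ M·Λ^g`; (S10) `towerDecorrelation_of_ancestorDecay` —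
  K6's shape `TowerDecorrelation μ s X σ (meanKernel lvl κ₀ ν) lvl B Λ ν` with the same `B`.
§5 CALIBRATION: (S11) `budget_mono` (monotone in `M`, `Aκ`); (S12) `fibre_factor_le_budget`
  (`M·Aκ ≤ B`: the `dist = 0` fibre alone costs the multiplicity factor `M`).

READING (cell analysis, located, NOT kernel beyond S1–S12, NOT printed): with these suppliers
the whole instance of NE1(ii)-DECORR for Bałaban's dressed pieces is (hdec) at every level with
level-independent `(Aκ, a)` — for the centred pieces themselves (S5–S8), or for the pieces
against conditional means of finer pieces together with the one-body contraction rate `ν`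
(S9–S10, K7 (M3)) — plus the counting datum `M` (pieces per block per level; for the co-read
pair pieces of one averaging step a finite `(d, L)`-dependent number, cell computation
C-pv05g8-3).  The `dist = 0` shell of the carver's why-fail is the `z = site p` fibre: it costs
the factor `M`, level-independently.
-/

noncomputable section

open MeasureTheory Finset
open scoped BigOperators

namespace Literature.MathematicalPhysics.QuantumFieldTheory.Balaban1983to89.T4SameLevelBudget

open Literature.MathematicalPhysics.QuantumFieldTheory.Balaban1983to89.B6KernelComposition
  (latticeConst latticeConst_pos sum_exp_dist_le)
open Literature.MathematicalPhysics.QuantumFieldTheory.Balaban1983to89.T4PairDecorrelation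
open Literature.MathematicalPhysics.QuantumFieldTheory.Balaban1983to89.T4TowerDecorrelation
open Literature.MathematicalPhysics.QuantumFieldTheory.Balaban1983to89.T4MeanChannel

/-! ## §1  Lattice row sums with fibre multiplicity (S1–S2) -/

section Lattice

variable {ι : Type*} {d : ℕ}

/-- (S1) [folklore] Regrouping a sum over pieces by their block labels: if every block `z ∈ ℤ^d`
carries at most `M` pieces of `s`, then `Σ_{q ∈ s} e^{−a|x − site q|_∞} ≤ M · latticeConst d a`
for every `x ∈ ℤ^d` and `a > 0` — uniformly in `s` (B6's `sum_exp_dist_le` on the image of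
`site`). -/
theorem sum_exp_dist_fibre_le (s : Finset ι) (site : ι → (Fin d → ℤ)) (x : Fin d → ℤ)
    {a : ℝ} (ha : 0 < a) {M : ℝ}
    (hfib : ∀ z : Fin d → ℤ, ((s.filter fun q => site q = z).card : ℝ) ≤ M) :
    ∑ q ∈ s, Real.exp (-(a * dist x (site q))) ≤ M * latticeConst d a := by
  classical
  have hM : 0 ≤ M := le_trans (Nat.cast_nonneg _) (hfib x)
  have hmaps : ∀ q ∈ s, site q ∈ s.image site := fun q hq => mem_image_of_mem site hq
  rw [← Finset.sum_fiberwise_of_maps_to hmaps]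
  calc ∑ z ∈ s.image site, ∑ q ∈ s.filter (fun q => site q = z), Real.exp (-(a * dist x (site q)))
      = ∑ z ∈ s.image site,
          ((s.filter fun q => site q = z).card : ℝ) * Real.exp (-(a * dist x z)) := by
        refine sum_congr rfl fun z _ => ?_
        rw [sum_congr rfl fun q hq => by rw [(mem_filter.mp hq).2], sum_const, nsmul_eq_mul]
    _ ≤ ∑ z ∈ s.image site, M * Real.exp (-(a * dist x z)) :=
        sum_le_sum fun z _ => mul_le_mul_of_nonneg_right (hfib z) (Real.exp_pos _).le
    _ = M * ∑ z ∈ s.image site, Real.exp (-(a * dist x z)) := by rw [mul_sum]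
    _ ≤ M * latticeConst d a := mul_le_mul_of_nonneg_left (sum_exp_dist_le _ x ha) hM

/-- (S2) [folklore] **ROW SUM FROM SITE DECAY.**  A kernel row dominated by
`Aκ · e^{−a|site p − site q|_∞}` (`Aκ ≥ 0`, `a > 0`) over a family with at most `M` pieces per
block sums to `≤ M · Aκ · latticeConst d a` — independent of `#s`. -/
theorem rowSum_le_of_siteDecay (s : Finset ι) (site : ι → (Fin d → ℤ)) (κ : ι → ι → ℝ) (p : ι)
    {Aκ a : ℝ} (hA : 0 ≤ Aκ) (ha : 0 < a) {M : ℝ}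
    (hfib : ∀ z : Fin d → ℤ, ((s.filter fun q => site q = z).card : ℝ) ≤ M)
    (hdec : ∀ q ∈ s, κ p q ≤ Aκ * Real.exp (-(a * dist (site p) (site q)))) :
    ∑ q ∈ s, κ p q ≤ M * Aκ * latticeConst d a :=
  calc ∑ q ∈ s, κ p q ≤ ∑ q ∈ s, Aκ * Real.exp (-(a * dist (site p) (site q))) := sum_le_sum hdec
    _ = Aκ * ∑ q ∈ s, Real.exp (-(a * dist (site p) (site q))) := by rw [mul_sum]
    _ ≤ Aκ * (M * latticeConst d a) :=
        mul_le_mul_of_nonneg_left (sum_exp_dist_fibre_le s site (site p) ha hfib) hA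
    _ = M * Aκ * latticeConst d a := by ring

/-- (S2ᵀ) [folklore] The column version of (S2) (the sup metric is symmetric). -/
theorem colSum_le_of_siteDecay (s : Finset ι) (site : ι → (Fin d → ℤ)) (κ : ι → ι → ℝ) (p : ι)
    {Aκ a : ℝ} (hA : 0 ≤ Aκ) (ha : 0 < a) {M : ℝ}
    (hfib : ∀ z : Fin d → ℤ, ((s.filter fun q => site q = z).card : ℝ) ≤ M)
    (hdec : ∀ q ∈ s, κ q p ≤ Aκ * Real.exp (-(a * dist (site q) (site p)))) :
    ∑ q ∈ s, κ q p ≤ M * Aκ * latticeConst d a :=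
  rowSum_le_of_siteDecay s site (fun p' q => κ q p') p hA ha hfib fun q hq => by
    rw [dist_comm]; exact hdec q hq

/-- (S2₊) [folklore] The budget is nonnegative as soon as one fibre bound holds. -/
theorem budget_nonneg (s : Finset ι) (site : ι → (Fin d → ℤ)) {Aκ a : ℝ} (hA : 0 ≤ Aκ)
    (ha : 0 < a) {M : ℝ} (hfib : ∀ z : Fin d → ℤ, ((s.filter fun q => site q = z).card : ℝ) ≤ M)
    (z : Fin d → ℤ) : 0 ≤ M * Aκ * latticeConst d a :=
  mul_nonneg (mul_nonneg (le_trans (Nat.cast_nonneg _) (hfib z)) hA) (latticeConst_pos d ha).le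

end Lattice

/-! ## §2  K5's level-blind shape from site decay (S3) -/

section Shape

variable {Ω : Type*} {mΩ : MeasurableSpace Ω} {μ : Measure Ω} {ι : Type*} {d : ℕ} {s : Finset ι}
  {X : ι → Ω → ℝ} {σ : ι → ℝ} {κ : ι → ι → ℝ}

/-- (S3) [folklore] **K5's SHAPE FROM SITE DECAY.**  Covariance domination (hcov) by a
nonnegative kernel dominated by `Aκ e^{−a|site p − site q|_∞}` (hdec), with at most `M` pieces
per block (hfib), gives `PairDecorrelation μ s X σ κ (M·Aκ·latticeConst d a)`.  Hypothesis shapes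
only; nothing is asserted about any particular law `μ`. -/
theorem pairDecorrelation_of_siteDecay (site : ι → (Fin d → ℤ)) {Aκ a M : ℝ} (hA : 0 ≤ Aκ)
    (ha : 0 < a) (hσ : ∀ p ∈ s, 0 ≤ σ p) (hκ : ∀ p ∈ s, ∀ q ∈ s, 0 ≤ κ p q)
    (hcov : ∀ p ∈ s, ∀ q ∈ s, |∫ ω, X p ω * X q ω ∂μ| ≤ κ p q * (σ p * σ q))
    (hdec : ∀ p ∈ s, ∀ q ∈ s, κ p q ≤ Aκ * Real.exp (-(a * dist (site p) (site q))))
    (hfib : ∀ z : Fin d → ℤ, ((s.filter fun q => site q = z).card : ℝ) ≤ M) :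
    PairDecorrelation μ s X σ κ (M * Aκ * latticeConst d a) where
  σ_nonneg := hσ
  κ_nonneg := hκ
  cov_le := hcov
  row_le p hp := rowSum_le_of_siteDecay s site κ p hA ha hfib fun q hq => hdec p hp q hq
  col_le q hq := colSum_le_of_siteDecay s site κ q hA ha hfib fun p hp => hdec p hp q hq

end Shape

/-! ## §3  Level-local instances: K7's conditionally centred bookkeeping (S4–S8) -/

section Levels

variable {Ω : Type*} {mΩ : MeasurableSpace Ω} {μ : Measure Ω} {ι : Type*} {d : ℕ} {s : Finset ι}
  {X : ι → Ω → ℝ} {b σ : ι → ℝ} {κ : ι → ι → ℝ} {F : ℕ → MeasurableSpace Ω} {lvl : ι → ℕ}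

/-- (S4) [folklore] The same-level row clause `hrow` of `T4MeanChannel.pairDecorrelation_sameLevel`
from SAME-LEVEL site decay (hdec, asked only for `lvl p = lvl q`; `site q` = the label of `q`'s
block in the lattice of ITS OWN level) and per-(level, block) fibre counts `≤ M`. -/
theorem sameLevel_rowSum_le (site : ι → (Fin d → ℤ)) {Aκ a M : ℝ} (hA : 0 ≤ Aκ) (ha : 0 < a)
    (hdec : ∀ p ∈ s, ∀ q ∈ s, lvl p = lvl q →
      κ p q ≤ Aκ * Real.exp (-(a * dist (site p) (site q))))
    (hfib : ∀ (j : ℕ) (z : Fin d → ℤ), ((s.filter fun q => lvl q = j ∧ site q = z).card : ℝ) ≤ M) :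
    ∀ p ∈ s, ∑ q ∈ s.filter (fun q => lvl q = lvl p), κ p q ≤ M * Aκ * latticeConst d a := by
  intro p hp
  refine rowSum_le_of_siteDecay _ site κ p hA ha (fun z => ?_) (fun q hq => ?_)
  · rw [Finset.filter_filter]; exact hfib (lvl p) z
  · have h := mem_filter.mp hq
    exact hdec p hp q h.1 h.2.symm

/-- (S4ᵀ) [folklore] The same-level column clause `hcol`. -/
theorem sameLevel_colSum_le (site : ι → (Fin d → ℤ)) {Aκ a M : ℝ} (hA : 0 ≤ Aκ) (ha : 0 < a)
    (hdec : ∀ p ∈ s, ∀ q ∈ s, lvl p = lvl q →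
      κ p q ≤ Aκ * Real.exp (-(a * dist (site p) (site q))))
    (hfib : ∀ (j : ℕ) (z : Fin d → ℤ), ((s.filter fun q => lvl q = j ∧ site q = z).card : ℝ) ≤ M) :
    ∀ p ∈ s, ∑ q ∈ s.filter (fun q => lvl q = lvl p), κ q p ≤ M * Aκ * latticeConst d a := by
  intro p hp
  refine colSum_le_of_siteDecay _ site κ p hA ha (fun z => ?_) (fun q hq => ?_)
  · rw [Finset.filter_filter]; exact hfib (lvl p) z
  · have h := mem_filter.mp hq
    exact hdec q h.1 p hp h.2

/-- (S5) [folklore] **K5's SHAPE, LEVEL-LOCAL, FROM SAME-LEVEL SITE DECAY** — for conditionally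
centred levelled pieces along an antitone filtration (K7's `hXm`/`hXc`), same-level covariance
domination (hcov), same-level site decay (hdec) and per-(level, block) fibres (hfib):
`PairDecorrelation μ s X σ (sameLevel lvl κ) (M·Aκ·latticeConst d a)` —
`T4MeanChannel.pairDecorrelation_sameLevel` BY NAME.  One number, valid however many levels `s`
spans; hypothesis shapes only. -/
theorem pairDecorrelation_sameLevel_of_siteDecay [IsFiniteMeasure μ] (hF : Antitone F)
    (hFle : ∀ j, F j ≤ mΩ) (hXm : ∀ p ∈ s, StronglyMeasurable[F (lvl p)] (X p))
    (hXb : ∀ p ∈ s, ∀ ω, |X p ω| ≤ b p) (hXc : ∀ p ∈ s, μ[X p | F (lvl p + 1)] =ᵐ[μ] 0)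
    (hσ : ∀ p ∈ s, 0 ≤ σ p) (hκ : ∀ p ∈ s, ∀ q ∈ s, 0 ≤ κ p q)
    (hcov : ∀ p ∈ s, ∀ q ∈ s, lvl p = lvl q →
      |∫ ω, X p ω * X q ω ∂μ| ≤ κ p q * (σ p * σ q))
    (site : ι → (Fin d → ℤ)) {Aκ a M : ℝ} (hA : 0 ≤ Aκ) (ha : 0 < a)
    (hdec : ∀ p ∈ s, ∀ q ∈ s, lvl p = lvl q →
      κ p q ≤ Aκ * Real.exp (-(a * dist (site p) (site q))))
    (hfib : ∀ (j : ℕ) (z : Fin d → ℤ), ((s.filter fun q => lvl q = j ∧ site q = z).card : ℝ) ≤ M) :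
    PairDecorrelation μ s X σ (sameLevel lvl κ) (M * Aκ * latticeConst d a) :=
  pairDecorrelation_sameLevel hF hFle hXm hXb hXc hσ hκ hcov
    (sameLevel_rowSum_le site hA ha hdec hfib) (sameLevel_colSum_le site hA ha hdec hfib)

/-- (S6) [folklore] The same data give K6's levelled shape with `ν = 0` and the same `B`, for
every `Λ` — `T4MeanChannel.towerDecorrelation_sameLevel` BY NAME. -/
theorem towerDecorrelation_sameLevel_of_siteDecay [IsFiniteMeasure μ] (hF : Antitone F)
    (hFle : ∀ j, F j ≤ mΩ) (hXm : ∀ p ∈ s, StronglyMeasurable[F (lvl p)] (X p))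
    (hXb : ∀ p ∈ s, ∀ ω, |X p ω| ≤ b p) (hXc : ∀ p ∈ s, μ[X p | F (lvl p + 1)] =ᵐ[μ] 0)
    (hσ : ∀ p ∈ s, 0 ≤ σ p) (hκ : ∀ p ∈ s, ∀ q ∈ s, 0 ≤ κ p q)
    (hcov : ∀ p ∈ s, ∀ q ∈ s, lvl p = lvl q →
      |∫ ω, X p ω * X q ω ∂μ| ≤ κ p q * (σ p * σ q))
    (site : ι → (Fin d → ℤ)) {Aκ a M : ℝ} (hA : 0 ≤ Aκ) (ha : 0 < a)
    (hdec : ∀ p ∈ s, ∀ q ∈ s, lvl p = lvl q →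
      κ p q ≤ Aκ * Real.exp (-(a * dist (site p) (site q))))
    (hfib : ∀ (j : ℕ) (z : Fin d → ℤ), ((s.filter fun q => lvl q = j ∧ site q = z).card : ℝ) ≤ M)
    (Λ : ℝ) :
    TowerDecorrelation μ s X σ (sameLevel lvl κ) lvl (M * Aκ * latticeConst d a) Λ 0 :=
  towerDecorrelation_sameLevel hF hFle hXm hXb hXc hσ hκ hcov
    (sameLevel_rowSum_le site hA ha hdec hfib) (sameLevel_colSum_le site hA ha hdec hfib) Λ

/-- (S7) [folklore] **SECOND MOMENT**: `∫ (Σ_p c_pX_p)² dμ ≤ (M·Aκ·latticeConst d a) · Σ_p (c_pσ_p)²`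
— `T4MeanChannel.integral_sq_sum_le_of_condCentred` BY NAME. -/
theorem integral_sq_sum_le_of_siteDecay [IsFiniteMeasure μ] (hF : Antitone F)
    (hFle : ∀ j, F j ≤ mΩ) (hXm : ∀ p ∈ s, StronglyMeasurable[F (lvl p)] (X p))
    (hXb : ∀ p ∈ s, ∀ ω, |X p ω| ≤ b p) (hXc : ∀ p ∈ s, μ[X p | F (lvl p + 1)] =ᵐ[μ] 0)
    (hσ : ∀ p ∈ s, 0 ≤ σ p) (hκ : ∀ p ∈ s, ∀ q ∈ s, 0 ≤ κ p q)
    (hcov : ∀ p ∈ s, ∀ q ∈ s, lvl p = lvl q →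
      |∫ ω, X p ω * X q ω ∂μ| ≤ κ p q * (σ p * σ q))
    (site : ι → (Fin d → ℤ)) {Aκ a M : ℝ} (hA : 0 ≤ Aκ) (ha : 0 < a)
    (hdec : ∀ p ∈ s, ∀ q ∈ s, lvl p = lvl q →
      κ p q ≤ Aκ * Real.exp (-(a * dist (site p) (site q))))
    (hfib : ∀ (j : ℕ) (z : Fin d → ℤ), ((s.filter fun q => lvl q = j ∧ site q = z).card : ℝ) ≤ M)
    (c : ι → ℝ) :
    ∫ ω, (∑ p ∈ s, c p * X p ω) ^ 2 ∂μ ≤ M * Aκ * latticeConst d a * ∑ p ∈ s, (c p * σ p) ^ 2 :=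
  integral_sq_sum_le_of_condCentred hF hFle hXm hXb hXc hσ hκ hcov
    (sameLevel_rowSum_le site hA ha hdec hfib) (sameLevel_colSum_le site hA ha hdec hfib) c

/-- (S8) [folklore] **HEADLINE FROM SAME-LEVEL SITE DECAY** (probability measure): conditionally
centred levelled pieces + (hcov)/(hdec)/(hfib) + the K11a level bookkeeping (counts
`≤ N₀Λ^{k−j}`, squared budgets `(c_pσ_p)² ≤ A(τ²)^{K−lvl p}`, `Λτ² ≤ r < 1`) and
`Σ|c_p|b_p ≤ 1` ⇒ `0 ≤ log ∫ exp(−Σ c_pX_p) dμ ≤ (M·Aκ·latticeConst d a) · N₀A/(1−r)` —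
`T4MeanChannel.log_integral_exp_neg_sum_le_line_of_condCentred` BY NAME: K-UNIFORM, with the
budget an explicit function of (M, Aκ, a, d) and NO cross-gap condition.  `(Aκ, a)` for Bałaban's
one-step conditional laws are NOT estimated here (row CDEC°, paper half). -/
theorem log_integral_exp_neg_sum_le_line_of_siteDecay [IsProbabilityMeasure μ]
    (hF : Antitone F) (hFle : ∀ j, F j ≤ mΩ)
    (hXm : ∀ p ∈ s, StronglyMeasurable[F (lvl p)] (X p)) (hXb : ∀ p ∈ s, ∀ ω, |X p ω| ≤ b p)
    (hXc : ∀ p ∈ s, μ[X p | F (lvl p + 1)] =ᵐ[μ] 0) (hσ : ∀ p ∈ s, 0 ≤ σ p)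
    (hκ : ∀ p ∈ s, ∀ q ∈ s, 0 ≤ κ p q)
    (hcov : ∀ p ∈ s, ∀ q ∈ s, lvl p = lvl q →
      |∫ ω, X p ω * X q ω ∂μ| ≤ κ p q * (σ p * σ q))
    (site : ι → (Fin d → ℤ)) {Aκ a M : ℝ} (hA : 0 ≤ Aκ) (ha : 0 < a) (hM : 0 ≤ M)
    (hdec : ∀ p ∈ s, ∀ q ∈ s, lvl p = lvl q →
      κ p q ≤ Aκ * Real.exp (-(a * dist (site p) (site q))))
    (hfib : ∀ (j : ℕ) (z : Fin d → ℤ), ((s.filter fun q => lvl q = j ∧ site q = z).card : ℝ) ≤ M)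
    {c : ι → ℝ} (hc1 : ∑ p ∈ s, |c p| * b p ≤ 1) {N₀ A Λ τ r : ℝ} {K k : ℕ} (hk : k ≤ K)
    (hlvl : ∀ p ∈ s, lvl p ≤ k)
    (hcard : ∀ j, j ≤ k → ((s.filter fun p => lvl p = j).card : ℝ) ≤ N₀ * Λ ^ (k - j))
    (hN₀ : 0 ≤ N₀) (hAsz : 0 ≤ A) (hΛ : 0 ≤ Λ) (hτ0 : 0 ≤ τ) (hτ1 : τ ≤ 1)
    (hr : Λ * τ ^ 2 ≤ r) (hr1 : r < 1)
    (hw : ∀ p ∈ s, (c p * σ p) ^ 2 ≤ A * (τ ^ 2) ^ (K - lvl p)) :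
    0 ≤ Real.log (∫ ω, Real.exp (-∑ p ∈ s, c p * X p ω) ∂μ) ∧
      Real.log (∫ ω, Real.exp (-∑ p ∈ s, c p * X p ω) ∂μ) ≤
        M * Aκ * latticeConst d a * (N₀ * A / (1 - r)) :=
  log_integral_exp_neg_sum_le_line_of_condCentred hF hFle hXm hXb hXc hσ hκ hcov
    (sameLevel_rowSum_le site hA ha hdec hfib) (sameLevel_colSum_le site hA ha hdec hfib)
    (mul_nonneg (mul_nonneg hM hA) (latticeConst_pos d ha).le) hc1 hk hlvl hcard hN₀ hAsz hΛ hτ0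
    hτ1 hr hr1 hw

end Levels

/-! ## §4  The mean-channel route: K7 (M3)'s clauses from ancestor decay (S9–S10) -/

section MeanChannel

variable {Ω : Type*} {mΩ : MeasurableSpace Ω} {μ : Measure Ω} {ι : Type*} {d : ℕ} {s : Finset ι}
  {X : ι → Ω → ℝ} {b σ : ι → ℝ} {κ₀ : ι → ι → ℝ} {F : ℕ → MeasurableSpace Ω} {lvl : ι → ℕ}
  {Λ : ℝ}

/-- (S9) [folklore] **DOWN-SLICE SUMS FROM ANCESTOR DECAY.**  `anc i q ∈ ℤ^d` = the label of the
level-`i` block containing the piece `q` (for `i = lvl q` its own block).  If, read from the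
COARSER end, `κ₀(p,q) ≤ Aκ e^{−a|anc (lvl p) p − anc (lvl p) q|_∞}` whenever `lvl q ≤ lvl p`
(hdec), and every level-`i` block is the ancestor of at most `M·Λ^g` pieces born `g` levels
below (hnest, nested counts), then `Σ_{q : lvl q + g = lvl p} κ₀(p,q) ≤ (M·Aκ·latticeConst d a)·Λ^g`
— the clause `hdown` of `T4MeanChannel.towerDecorrelation_of_meanChannel` with
`B = M·Aκ·latticeConst d a`. -/
theorem downSum_le_of_ancestorDecay (anc : ℕ → ι → (Fin d → ℤ)) {Aκ a M : ℝ} (hA : 0 ≤ Aκ)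
    (ha : 0 < a)
    (hdec : ∀ p ∈ s, ∀ q ∈ s, lvl q ≤ lvl p →
      κ₀ p q ≤ Aκ * Real.exp (-(a * dist (anc (lvl p) p) (anc (lvl p) q))))
    (hnest : ∀ (i g : ℕ) (z : Fin d → ℤ),
      ((s.filter fun q => lvl q + g = i ∧ anc i q = z).card : ℝ) ≤ M * Λ ^ g) :
    ∀ p ∈ s, ∀ g : ℕ, ∑ q ∈ s.filter (fun q => lvl q + g = lvl p), κ₀ p q ≤
      M * Aκ * latticeConst d a * Λ ^ g := by
  intro p hp g
  have h := rowSum_le_of_siteDecay (s.filter fun q => lvl q + g = lvl p) (anc (lvl p)) κ₀ p hA ha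
    (M := M * Λ ^ g) (fun z => by rw [Finset.filter_filter]; exact hnest (lvl p) g z)
    (fun q hq => by
      have hq' := mem_filter.mp hq
      exact hdec p hp q hq'.1 (by omega))
  calc ∑ q ∈ s.filter (fun q => lvl q + g = lvl p), κ₀ p q ≤ M * Λ ^ g * Aκ * latticeConst d a := h
    _ = M * Aκ * latticeConst d a * Λ ^ g := by ring

/-- (S9ᵀ) [folklore] The transposed same-level clause `hsameT` of
`T4MeanChannel.towerDecorrelation_of_meanChannel` from the same data (at equal levels the two
ancestor maps coincide and the sup metric is symmetric; the `g = 0` nested count is the plain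
fibre count). -/
theorem sameLevelT_le_of_ancestorDecay (anc : ℕ → ι → (Fin d → ℤ)) {Aκ a M : ℝ} (hA : 0 ≤ Aκ)
    (ha : 0 < a)
    (hdec : ∀ p ∈ s, ∀ q ∈ s, lvl q ≤ lvl p →
      κ₀ p q ≤ Aκ * Real.exp (-(a * dist (anc (lvl p) p) (anc (lvl p) q))))
    (hnest : ∀ (i g : ℕ) (z : Fin d → ℤ),
      ((s.filter fun q => lvl q + g = i ∧ anc i q = z).card : ℝ) ≤ M * Λ ^ g) :
    ∀ p ∈ s, ∑ q ∈ s.filter (fun q => lvl q = lvl p), κ₀ q p ≤ M * Aκ * latticeConst d a := by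
  intro p hp
  have hfib : ∀ z : Fin d → ℤ,
      (((s.filter fun q => lvl q = lvl p).filter fun q => anc (lvl p) q = z).card : ℝ) ≤ M := by
    intro z
    have h0 := hnest (lvl p) 0 z
    rw [pow_zero, mul_one] at h0
    rw [Finset.filter_filter]
    have hset : (s.filter fun q => lvl q = lvl p ∧ anc (lvl p) q = z) =
        s.filter fun q => lvl q + 0 = lvl p ∧ anc (lvl p) q = z :=
      filter_congr fun q _ => by rw [add_zero]
    rw [hset]; exact h0
  refine colSum_le_of_siteDecay _ (anc (lvl p)) κ₀ p hA ha hfib fun q hq => ?_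
  have hq' := mem_filter.mp hq
  have hl : lvl q = lvl p := hq'.2
  have h := hdec q hq'.1 p hp hl.ge
  rw [hl] at h
  exact h

/-- (S10) [folklore] **K6's LEVELLED SHAPE THROUGH THE MEAN CHANNEL FROM ANCESTOR DECAY.**  The
hypotheses of `T4MeanChannel.towerDecorrelation_of_meanChannel` — (hmean) same-level
decorrelation of `X_p` against the conditional means `μ[X_q | F (lvl p)]` at scale `ν^{gap}σ_q`
— with its two counting clauses supplied by (S9)/(S9ᵀ):
`TowerDecorrelation μ s X σ (meanKernel lvl κ₀ ν) lvl (M·Aκ·latticeConst d a) Λ ν`.  READING: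
on this route the cell's number ν (one-body contraction of conditional means up the tower,
O-G7 species) stays a SEPARATE hypothesis inside (hmean); `B` is the same explicit number as in
§3.  Shapes only. -/
theorem towerDecorrelation_of_ancestorDecay [IsFiniteMeasure μ] (hFle : ∀ j, F j ≤ mΩ)
    (hXm : ∀ p ∈ s, StronglyMeasurable[F (lvl p)] (X p)) (hXb : ∀ p ∈ s, ∀ ω, |X p ω| ≤ b p)
    (hσ : ∀ p ∈ s, 0 ≤ σ p) (hκ₀ : ∀ p ∈ s, ∀ q ∈ s, 0 ≤ κ₀ p q) {ν : ℝ} (hν : 0 ≤ ν)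
    (hmean : ∀ p ∈ s, ∀ q ∈ s, lvl q ≤ lvl p →
      |∫ ω, X p ω * μ[X q | F (lvl p)] ω ∂μ| ≤ κ₀ p q * ν ^ (lvl p - lvl q) * (σ p * σ q))
    (anc : ℕ → ι → (Fin d → ℤ)) {Aκ a M : ℝ} (hA : 0 ≤ Aκ) (ha : 0 < a)
    (hdec : ∀ p ∈ s, ∀ q ∈ s, lvl q ≤ lvl p →
      κ₀ p q ≤ Aκ * Real.exp (-(a * dist (anc (lvl p) p) (anc (lvl p) q))))
    (hnest : ∀ (i g : ℕ) (z : Fin d → ℤ),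
      ((s.filter fun q => lvl q + g = i ∧ anc i q = z).card : ℝ) ≤ M * Λ ^ g) :
    TowerDecorrelation μ s X σ (meanKernel lvl κ₀ ν) lvl (M * Aκ * latticeConst d a) Λ ν :=
  towerDecorrelation_of_meanChannel hFle hXm hXb hσ hκ₀ hν hmean
    (downSum_le_of_ancestorDecay anc hA ha hdec hnest)
    (sameLevelT_le_of_ancestorDecay anc hA ha hdec hnest)

end MeanChannel

/-! ## §5  Calibration of the number (S11–S12) -/

section Calibration

/-- (S11) [folklore] The budget is monotone in the fibre multiplicity and in the decay amplitude:
`M ≤ M′`, `Aκ ≤ Aκ′` (all nonnegative) ⇒ `M·Aκ·C ≤ M′·Aκ′·C` for `C = latticeConst d a ≥ 0`. -/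
theorem budget_mono {d : ℕ} {a M M' Aκ Aκ' : ℝ} (ha : 0 < a) (hM : 0 ≤ M) (hMM : M ≤ M')
    (hA : 0 ≤ Aκ) (hAA : Aκ ≤ Aκ') :
    M * Aκ * latticeConst d a ≤ M' * Aκ' * latticeConst d a :=
  mul_le_mul_of_nonneg_right (mul_le_mul hMM hAA hA (hM.trans hMM)) (latticeConst_pos d ha).le

/-- (S12) [folklore] THE `dist = 0` SHELL COSTS EXACTLY THE FIBRE FACTOR: since
`latticeConst d a ≥ 1` (the `z = x` term alone), the budget is at least `M·Aκ` — with ALL pieces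
in ONE block (`site` constant) (hfib) reads `#s ≤ M`, so the budget is then linear in the block
population.  The carver's why-fail («the dist = 0 shell has ~d·L^d members») is this factor
`M`: a finite per-(level, block) multiplicity, not a growth in the number of levels. -/
theorem fibre_factor_le_budget {d : ℕ} {a M Aκ : ℝ} (ha : 0 < a) (hM : 0 ≤ M) (hA : 0 ≤ Aκ) :
    M * Aκ ≤ M * Aκ * latticeConst d a :=
  le_mul_of_one_le_right (mul_nonneg hM hA) (B6KernelComposition.one_le_latticeConst d ha)

end Calibration

end Literature.MathematicalPhysics.QuantumFieldTheory.Balaban1983to89.T4SameLevelBudget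

end
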